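import Mathlib
import Summits.Ventures.PercRepro.TriangleCapRowACapMain

/-!
# PercRepro — THE CAP ON THE CELL `(k, a, a + 1)` FOR EVERY ROW `a ≥ 8`, THE PIECES: with `a + 1` missing pairs the
non-bipartite gap of the cap graphs is at least `2k − 10` — the count, the `R`-sum with deficit `3`, the loss of the
two ends and of the non-ends, and the arithmetic (p3, gen 47; part 200r)

At `r = a + 1` (`K = k − a`, `|R| = a − 1`): an edge inside `R` is impossible for every `K ≥ 2a + 1` with the
per-vertex degree caps of its ends (`rowA1_noedge`); `E = 0`, `(a − 2) M ≤ a + 1` gives `M ≤ 1` (`a ≥ 6`); `M = 1`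
has `P = (a − 1) K − a − 2`, deficit `3`: `Σ_R d² + 3 (2K − 5) ≤ (a − 1)(K − 1)²` (`rowA1_R_sum`). On `N` the
exact identity of part 200m and the loss: the `a + 2` misses of `R` into `N` put `m₁ + m₂ ≥ a − 1` on the two ends
`y₁, y₂` (every `u ∈ R` misses one of them), so at most `3` on the non-ends — each non-end pays `(a − 4)` per miss
(`rowA_loss_vertex'`) — and the ends pay `m₁(a−1−m₁) + m₂(a−1−m₂) = e (a − 1 − e) + 2 (a−1−m₁)(a−1−m₂) ≥ e (a − 4)`
for `e = m₁ + m₂ − (a − 1) ≤ 3` (`rowA1_ends_loss`): the loss is at least `3 (a − 4)`, and the arithmetic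
`rowA1_sq_arith` closes with slack `2a − 16` (`a ≥ 8`; the one-triangle family `tFamilyGen (k − 1) a 3`, a cap graph
`2k + 2a − 20` below, is the true cap minimum, slack `2a − 10`). Axioms: standard.
-/

namespace PercRepro

namespace TriangleCap

namespace C047

open Finset

/-- **THE COUNT AT `r = a + 1` WITH AN EDGE INSIDE `R`:** impossible for `K ≥ 2a + 1` (`a = a' + 5`). -/
theorem rowA1_noedge (a' K M P E m Pu Pv Pr du dv dr : ℕ) (hK : 2 * (a' + 5) + 1 ≤ K)
    (hdeg : K + (K + 2 * M + P) + (P + E) = 2 * m) (hm : m + (a' + 6) = (a' + 5) * K)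
    (h1 : P + E ≤ (a' + 4) * K) (hPuv : Pu + Pv ≤ K + 1) (hrest : Pr + (a' + 2) * M ≤ (a' + 2) * K)
    (hP : P = Pu + Pv + Pr) (hE : E = du + dv + dr) (hu : Pu + du ≤ K) (hv : Pv + dv ≤ K)
    (hr : Pr + dr ≤ (a' + 2) * K) (hdu : du ≤ a' + 3) (hdv : dv ≤ a' + 3) : False := by
  subst hP hE
  obtain ⟨t, rfl⟩ : ∃ t, K = 2 * (a' + 5) + 1 + t := ⟨K - (2 * (a' + 5) + 1), by omega⟩
  nlinarith [hdeg, hm, h1, hPuv, hrest, hu, hv, hr, hdu, hdv, Nat.zero_le (a' * M), Nat.zero_le (t * M),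
    Nat.zero_le (a' * t)]

/-- `(a − 2) M ≤ a + 1` ⇒ `M ≤ 1` (`a ≥ 6`). -/
theorem rowA1_matching (a K M P m : ℕ) (ha : 6 ≤ a) (hdeg : K + (K + 2 * M + P) + (P + 0) = 2 * m)
    (hm : m + (a + 1) = a * K) (h2 : P + (a - 1) * M ≤ (a - 1) * K) : M ≤ 1 := by
  by_contra hM
  have hM2 : 2 ≤ M := by omega
  obtain ⟨a', rfl⟩ : ∃ a', a = a' + 6 := ⟨a - 6, by omega⟩
  have e : a' + 6 - 1 = a' + 5 := by omega
  rw [e] at h2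
  have hMM : (a' + 4) * 2 ≤ (a' + 4) * M := Nat.mul_le_mul_left _ hM2
  nlinarith [hdeg, hm, h2, hMM]

/-- A vertex of `R` at `P ∈ {K − 4, …, K − 1}`: `P² + (2K − 5)(K − 1) ≤ (K − 1)² + (2K − 5) P`. -/
theorem rowA1_R_vertex (P K : ℕ) (hK : 4 ≤ K) (hP1 : P + 1 ≤ K) (hP2 : K ≤ P + 4) :
    P * P + (2 * K - 5) * (K - 1) ≤ (K - 1) * (K - 1) + (2 * K - 5) * P := by
  obtain ⟨t, rfl⟩ : ∃ t, K = t + 4 := ⟨K - 4, by omega⟩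
  have e1 : 2 * (t + 4) - 5 = 2 * t + 3 := by omega
  have e2 : t + 4 - 1 = t + 3 := by omega
  rw [e1, e2]
  rcases Nat.lt_or_ge P (t + 1) with h | h
  · have : P = t := by omega
    subst this
    nlinarith
  · rcases Nat.lt_or_ge P (t + 2) with h' | h'
    · have : P = t + 1 := by omega
      subst this
      nlinarith
    · rcases Nat.lt_or_ge P (t + 3) with h'' | h''
      · have : P = t + 2 := by omega
        subst this
        nlinarith
      · have : P = t + 3 := by omega
        subst this
        nlinarith

variable {V : Type*} [DecidableEq V]

/-- **THE `R`-SUM AT `M = 1`, `r = a + 1`:** every `u ∈ R` at `≤ K − 1`, `Σ_R degIn N + 3 = |R| (K − 1)` ⇒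
`Σ_R (degIn N)² + 3 (2K − 5) ≤ |R| (K − 1)²` (`K ≥ 4`). -/
theorem rowA1_R_sum (D : SimpleGraph V) [DecidableRel D.Adj] (R N : Finset V) (K : ℕ) (hK : 4 ≤ K)
    (hPle : ∀ u ∈ R, degIn D N u + 1 ≤ K) (hsum : ∑ u ∈ R, degIn D N u + 3 = R.card * (K - 1)) :
    ∑ u ∈ R, degIn D N u * degIn D N u + (2 * K - 5) * 3 ≤ R.card * ((K - 1) * (K - 1)) := by
  have hlow : ∀ u ∈ R, K ≤ degIn D N u + 4 := by
    intro u hu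
    have h1 := add_sum_erase R (fun w => degIn D N w) hu
    have h2 : ∑ w ∈ R.erase u, degIn D N w ≤ ∑ _w ∈ R.erase u, (K - 1) :=
      sum_le_sum (fun w hw => by have := hPle w (mem_of_mem_erase hw); omega)
    rw [sum_const, smul_eq_mul, card_erase_of_mem hu] at h2
    have hR1 : 1 ≤ R.card := card_pos.mpr ⟨u, hu⟩
    have e : R.card * (K - 1) = (R.card - 1) * (K - 1) + (K - 1) := by
      obtain ⟨c, hc⟩ : ∃ c, R.card = c + 1 := ⟨R.card - 1, by omega⟩
      rw [hc, Nat.add_sub_cancel, add_mul, one_mul]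
    omega
  have h := sum_le_sum (fun u hu => rowA1_R_vertex (degIn D N u) K hK (hPle u hu) (hlow u hu))
  rw [sum_add_distrib, sum_add_distrib, sum_const, sum_const, smul_eq_mul, smul_eq_mul, ← mul_sum] at h
  have e1 : (2 * K - 5) * (∑ u ∈ R, degIn D N u + 3) = (2 * K - 5) * ∑ u ∈ R, degIn D N u + (2 * K - 5) * 3 :=
    mul_add _ _ _
  rw [hsum] at e1
  have e2 : R.card * ((2 * K - 5) * (K - 1)) = (2 * K - 5) * (R.card * (K - 1)) := by ring
  rw [e2] at h
  omega

/-- A non-end missed by at most `3` vertices of `R` (`a − 1 − g ≤ 3`, `a ≥ 8`) pays `g (a − 1 − g) ≥ (a − 4)(a − 1 − g)`. -/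
theorem rowA_loss_vertex' (g a : ℕ) (ha : 8 ≤ a) (hmiss : a - 1 - g ≤ 3) :
    (a - 4) * (a - 1 - g) ≤ g * (a - 1 - g) := by
  apply Nat.mul_le_mul_right
  omega

/-- **THE LOSS OF THE TWO ENDS:** `m₁, m₂ ≤ a − 1`, `m₁ + m₂ = a − 1 + e`, `e ≤ 3`, `a ≥ 8` ⇒
`e (a − 4) ≤ m₁ (a − 1 − m₁) + m₂ (a − 1 − m₂)` (the identity `= e (a − 1 − e) + 2 (a − 1 − m₁)(a − 1 − m₂)`). -/
theorem rowA1_ends_loss (m₁ m₂ e a : ℕ) (ha : 8 ≤ a) (h1 : m₁ + 1 ≤ a) (h2 : m₂ + 1 ≤ a)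
    (he : m₁ + m₂ = a - 1 + e) (he3 : e ≤ 3) :
    e * (a - 4) ≤ m₁ * (a - 1 - m₁) + m₂ * (a - 1 - m₂) := by
  obtain ⟨x, hx⟩ : ∃ x, a - 1 - m₁ = x := ⟨_, rfl⟩
  obtain ⟨y, hy⟩ : ∃ y, a - 1 - m₂ = y := ⟨_, rfl⟩
  have hm1 : m₁ + x = a - 1 := by omega
  have hm2 : m₂ + y = a - 1 := by omega
  rw [hx, hy]
  have hxy : x + y + e = a - 1 := by omega
  obtain ⟨c, rfl⟩ : ∃ c, a = c + 8 := ⟨a - 8, by omega⟩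
  have e1 : c + 8 - 4 = c + 4 := by omega
  have e2 : c + 8 - 1 = c + 7 := by omega
  rw [e1]
  rw [e2] at hm1 hm2 hxy
  obtain rfl : m₁ = c + 7 - x := by omega
  obtain rfl : m₂ = c + 7 - y := by omega
  have hx' : x ≤ c + 7 := by omega
  have hy' : y ≤ c + 7 := by omega
  obtain ⟨m₁', hm₁'⟩ : ∃ m₁', c + 7 - x = m₁' := ⟨_, rfl⟩
  obtain ⟨m₂', hm₂'⟩ : ∃ m₂', c + 7 - y = m₂' := ⟨_, rfl⟩
  rw [hm₁', hm₂']
  have h1' : m₁' + x = c + 7 := by omega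
  have h2' : m₂' + y = c + 7 := by omega
  nlinarith [h1', h2', hxy, Nat.zero_le (x * y)]

/-- **THE ARITHMETIC OF `M = 1` AT `r = a + 1`:** `a ≥ 8`, `K ≥ 2a + 1`, `m + a + 1 = aK`, `P + a + 2 + K = aK`,
`S_N + 3 (a − 4) ≤ K + 6 + (a + 1) P + 2 (a − 1)`, `S_R + 3 (2K − 5) ≤ (a − 1)(K − 1)²` ⇒
`K² + S_N + S_R + (a + 1)(k − 1 − (a + 1)) + (2k − 10) ≤ m k`, `k = K + a`; slack `2a − 16`. -/
theorem rowA1_sq_arith (a K P SN SR m : ℕ) (ha : 8 ≤ a) (hK : 2 * a + 1 ≤ K) (hm : m + (a + 1) = a * K)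
    (hP : P + (a + 2) + K = a * K) (hSN : SN + 3 * (a - 4) ≤ K + 6 + (a + 1) * P + 2 * (a - 1))
    (hSR : SR + (2 * K - 5) * 3 ≤ (a - 1) * ((K - 1) * (K - 1))) :
    K * K + SN + SR + (a + 1) * (K + a - 1 - (a + 1)) + (2 * (K + a) - 10) ≤ m * (K + a) := by
  obtain ⟨q, rfl⟩ : ∃ q, a = q + 8 := ⟨a - 8, by omega⟩
  obtain ⟨t, rfl⟩ : ∃ t, K = 2 * (q + 8) + 1 + t := ⟨K - (2 * (q + 8) + 1), by omega⟩
  have e1 : 2 * (q + 8) + 1 + t + (q + 8) - 1 - (q + 8 + 1) = 2 * q + t + 15 := by omega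
  have e2 : 2 * (2 * (q + 8) + 1 + t + (q + 8)) - 10 = 6 * q + 2 * t + 40 := by omega
  have e3 : q + 8 - 4 = q + 4 := by omega
  have e4 : q + 8 - 1 = q + 7 := by omega
  have e5 : 2 * (q + 8) + 1 + t - 1 = 2 * q + t + 16 := by omega
  have e6 : 2 * (2 * (q + 8) + 1 + t) - 5 = 4 * q + 2 * t + 29 := by omega
  rw [e1, e2]
  rw [e3, e4] at hSN
  rw [e4, e5, e6] at hSR
  have hm' : m = 2 * q * q + 32 * q + q * t + 8 * t + 127 := by ring_nf at hm ⊢; omega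
  have hP' : P = 2 * q * q + 30 * q + q * t + 7 * t + 109 := by ring_nf at hP ⊢; omega
  subst hm' hP'
  nlinarith [hSN, hSR]

end C047

end TriangleCap

end PercRepro
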